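import Summits.ValiantsHypothesis.ValiantsHypothesis.Theses.BarrierLever
import Literature.Computability.AlgebraicComplexity.ArithCircuitProofs
import Summits.ValiantsHypothesis.ValiantsHypothesis.Theorems.BarrierLeverSuccinctHittingSetsForVPStubRestrict
import Summits.ValiantsHypothesis.ValiantsHypothesis.Theorems.BarrierLeverSuccinctHittingSetsForVPLevelOne
import Summits.ValiantsHypothesis.ValiantsHypothesis.Theorems.BarrierLeverSuccinctHittingSetsForVPShiftedSupport
import Summits.ValiantsHypothesis.ValiantsHypothesis.Theorems.BarrierLeverSuccinctHittingSetsForVPStubProdSparsity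
import Summits.ValiantsHypothesis.ValiantsHypothesis.Theorems.BarrierLeverSuccinctHittingSetsForVPStubShiftSmallSupport
import Summits.ValiantsHypothesis.ValiantsHypothesis.Theorems.BarrierLeverSuccinctHittingSetsForVPStubFullSupport
import Summits.ValiantsHypothesis.ValiantsHypothesis.Theorems.BarrierLeverSuccinctHittingSetsForVPStubSparseGlue
import Summits.ValiantsHypothesis.ValiantsHypothesis.Theorems.BarrierLeverSuccinctHittingSetsForVPSparse
import Summits.ValiantsHypothesis.ValiantsHypothesis.Theorems.BarrierLeverSuccinctHittingSetsForVPDimensionCount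
import Summits.ValiantsHypothesis.ValiantsHypothesis.Theorems.BarrierLeverSuccinctHittingSetsForVPSuperDense
import Summits.ValiantsHypothesis.ValiantsHypothesis.Theorems.BarrierLeverSuccinctHittingSetsForVPGenerator
import Summits.ValiantsHypothesis.ValiantsHypothesis.Theorems.BarrierLeverSuccinctHittingSetsForVPStubDerivDimension
import Summits.ValiantsHypothesis.ValiantsHypothesis.Theorems.BarrierLeverSuccinctHittingSetsForVPStubLowPartialsHit
import Summits.ValiantsHypothesis.ValiantsHypothesis.Theorems.BarrierLeverSuccinctHittingSetsForVPStubSigmaLambdaSigma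
import Summits.ValiantsHypothesis.ValiantsHypothesis.Theorems.BarrierLeverSuccinctHittingSetsForVPLowPartials
import Summits.ValiantsHypothesis.ValiantsHypothesis.Theorems.BarrierLeverSuccinctHittingSetsForVPStubMultilinearBase
import Summits.ValiantsHypothesis.ValiantsHypothesis.Theorems.BarrierLeverSuccinctHittingSetsForVPStubMultilinearCoords
import Summits.ValiantsHypothesis.ValiantsHypothesis.Theorems.BarrierLeverSuccinctHittingSetsForVPStubMultilinearSparseGlue
import Summits.ValiantsHypothesis.ValiantsHypothesis.Theorems.BarrierLeverSuccinctHittingSetsForVPMultilinearSparse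
import Summits.ValiantsHypothesis.ValiantsHypothesis.Theorems.BarrierLeverSuccinctHittingSetsForVPStubRisingDiagonal
import Summits.ValiantsHypothesis.ValiantsHypothesis.Theorems.BarrierLeverSuccinctHittingSetsForVPStubPartialsIndependent
import Summits.ValiantsHypothesis.ValiantsHypothesis.Theorems.BarrierLeverSuccinctHittingSetsForVPPartialsMaximal
import Literature.Computability.AlgebraicComplexity.ApolarityAction
import Literature.Barriers.ValiantsHypothesis.FullRankMultilinear
import Summits.ValiantsHypothesis.ValiantsHypothesis.Theorems.BarrierLeverSuccinctHittingSetsForVPStubCatalecticantMaximal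
import Summits.ValiantsHypothesis.ValiantsHypothesis.Theorems.BarrierLeverSuccinctHittingSetsForVPStubPartitionRankMaximal
import Summits.ValiantsHypothesis.ValiantsHypothesis.Theorems.BarrierLeverSuccinctHittingSetsForVPStubFullRankSmallCircuit
import Summits.ValiantsHypothesis.ValiantsHypothesis.Theorems.BarrierLeverSuccinctHittingSetsForVPStubFewLinearForms
import Summits.ValiantsHypothesis.ValiantsHypothesis.Theorems.BarrierLeverSuccinctHittingSetsForVPRazDeterminant
import Summits.ValiantsHypothesis.ValiantsHypothesis.Theorems.BarrierLeverSuccinctHittingSetsForVPStubAffineFormIrreducible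
import Summits.ValiantsHypothesis.ValiantsHypothesis.Theorems.BarrierLeverSuccinctHittingSetsForVPStubSps2NotAnnihilated
import Summits.ValiantsHypothesis.ValiantsHypothesis.Theorems.BarrierLeverSuccinctHittingSetsForVPStubSps2Hit
import Summits.ValiantsHypothesis.ValiantsHypothesis.Theorems.BarrierLeverSuccinctHittingSetsForVPStubCatalecticantDeterminant
import Summits.ValiantsHypothesis.ValiantsHypothesis.Theorems.BarrierLeverSuccinctHittingSetsForVPStubCounterexampleProfile
import Summits.ValiantsHypothesis.ValiantsHypothesis.Theorems.BarrierLeverSuccinctHittingSetsForVPSps2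
import Summits.ValiantsHypothesis.ValiantsHypothesis.Theorems.BarrierLeverSuccinctHittingSetsForVPHomogeneous
import Summits.ValiantsHypothesis.ValiantsHypothesis.Theorems.BarrierLeverSuccinctHittingSetsForVPHeart
import Summits.ValiantsHypothesis.ValiantsHypothesis.Theorems.BarrierLeverSuccinctHittingSetsForVPIsobaricComponents
import Summits.ValiantsHypothesis.ValiantsHypothesis.Theorems.BarrierLeverSuccinctHittingSetsForVPStubIsobaricReduction
import Summits.ValiantsHypothesis.ValiantsHypothesis.Theorems.BarrierLeverSuccinctHittingSetsForVPStubPartitionDeterminantHit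
import Summits.ValiantsHypothesis.ValiantsHypothesis.Theorems.BarrierLeverSuccinctHittingSetsForVPStubPartitionDeterminantLevel
import Summits.ValiantsHypothesis.ValiantsHypothesis.Theorems.BarrierLeverSuccinctHittingSetsForVPSpsk

/-!
# Skeleton — crux `SuccinctHittingSetsForVP` (route BarrierLever, item stmt-ValiantsHypothesis-14610),
line `registered` (birth): LEVEL COLLAPSE BY PADDING — v20 (lead c5: + wave 10 = principal catalecticant
minors of any size `stub_principalMinors`/`stub_principalMinorsHit`, the no-go for low-partition-rank
generators `stub_lowRankAnnihilated`/`stub_separableSumsAnnihilated`, read-once distinguishers to be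
registered once `IsPROP` p172784 lands; heart unchanged) — formerly v12 (lead c4): the super-dense heart plus
wave 6, which carves the remaining RANK-METHOD classes of the barrier catalogue (coefficient /
catalecticant matrices, partition coefficient matrices, Raz's all-partitions full rank) and the
distinguishers with few essential variables out of level one, as four registered worker stubs.

The crux is Forbes–Shpilka–Volk's Question 6 over `ℂ` in the tree's regime
(`Literature.Barriers.ValiantsHypothesis.SuccinctHittingSetsForVP ℂ`):
`∀ a, ∃ b n₀, ∀ n ≥ n₀, IsSuccinctHittingSet (degLEMonomials n) (SmallCircuits ℂ n b) (Distinguishers ℂ n a)`.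

COMPOSITION (registered, v18): crux ⟸ `stub_levelCollapse` (level one ⇒ every level; c1, LANDED p144631)
⟸ `stub_homogeneousReduction` (LANDED p164794) ⟸ `stub_isobaricReduction` (LANDED p167193) applied to the ONE
OPEN STUB `stub_heart` (bihomogeneous ∧ super-dense ∧ level 16 — ≡ crux, `succinctHittingSetsForVP_iff_isobaric`);
v16–v17: ⟸ `stub_heartReduction` (LANDED p165233) applied to the hom ∧ super-dense ∧ level-4 heart; formerly (v11–v15) ⟸ `stub_levelOneOfSuperDense` (LANDED p154735) applied to `stub_superDense`:
"for some `b`, eventually in `n`, `SmallCircuits ℂ n b` hits every nonzero `D` with `L(D) ≤ N`,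
`deg D ≤ N`, `N = C(2n,n)`, and MORE than `2^(n^(b-3))` monomials" — EQUIVALENT to the crux
(`succinctHittingSetsForVP_iff_superDense`, p154735). This is FSV Question 6 itself (open problem).

CARVED OUT OF LEVEL ONE (all LANDED `--supports`, unconditional; FSV18 Thm. 9-type evidence in regime
`d = n`; each says: these distinguishers are never algebraically natural proofs against `VP`):
* wave 1 — SPARSE: `N^a`-sparse `D` (any degree/size) are hit by `SmallCircuits ℂ n 4`
  (`stub_prodSparsity` p152268 = FSV L33, `stub_shiftSmallSupport` p152031 = FSV L32,
  `stub_fullSupport` p151912, `stub_sparseGlue` p151756, assembly `stub_sparse` p152812 with the master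
  form and "equations have `> 2^(n^(b-3))` monomials");
* wave 2 — GENERATOR / PRODUCTS: one polynomial map Γ (shifted succinct SV generator, FSV Constr. 25/29)
  realisable in `SmallCircuits ℂ n 10` and annihilated by no nonzero `N^a`-sparse `D`; products of
  sparse polynomials (`ΠΣΠ` with sparse factors, `ΠΣ`) are hit (`stub_separableCoeff` p153631,
  `stub_svHit` p153658, `stub_lagrangeIndicator` p153467, `stub_generatorGlue` p153704, assembly
  `stub_sparseProducts` p155376);
* lead — SUPER-DENSE REDUCTION (p154735): crux ⟺ `stub_superDense`;
* wave 3 — FEW PARTIAL DERIVATIVES: `D` whose partials span `≤ N^a` dimensions (e.g. `ΣΛΣ`, sums of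
  powers of affine forms) are hit by `SmallCircuits ℂ n 3`; dually natural proofs against size `n^b`
  have `> 2^(n^(b-2))`-dimensional partial-derivative space (`stub_derivDimension` p155871,
  `stub_lowPartialsHit` p155623, `stub_sigmaLambdaSigma` p155760, assembly `stub_lowPartials` p156205);
* wave 4 — SPARSE RELATIVE TO THE MULTILINEAR SLICE (FSV Thm. 9 in its own regime; the
  `P = multilinearSlice` case of the narrowed barrier `AlgebraicNaturalProofsNarrow`, sparse `𝒟`):
  `IsSuccinctHittingSetRel (degLEMonomials n) (multilinearSlice ℂ n) (SmallCircuits ℂ n 3) {N^a-sparse}`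
  (`stub_multilinearBase` p156897, `stub_multilinearCoords` p156800, `stub_multilinearSparseGlue` p157017,
  assembly `stub_multilinearSparse` p157443);
* wave 5 — PARTIAL-DERIVATIVE MEASURE MAXIMAL on `SmallCircuits ℂ n 8` (the all-ones polynomial has
  linearly independent order-`k` partials, `k ≤ n/2`: Nisan–Wigderson's rank method at full threshold
  is no natural proof against `VP` here): `stub_risingDiagonal` p158170, `stub_partialsIndependent`
  p158066, assembly `stub_partialsMaximal` p158554.
Inherited structure (c2): LowDegree p146310, DimensionCount p146692, LowSupport p147275,
LowDegreeEquations p147370 (equations without the size bound EXIST), ShiftedSupport p147641,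
PolyParametrization p147760, UniversalSize p148055, GeneratorEquivalence p148189.

History: birth skeleton (planner, sha f6fd523d): `stub_levelOne` + `stub_restrict`; c1 landed
`stub_restrict` p143416, `stub_levelCollapse` p144631; c2 (sha 9610d816) landed the eight structure
files; c3: v2 `levelOne ⟸ sparse ∧ dense` (wave 1), v3 generator form (wave 2), v4 super-dense
reduction, v5 low partials (wave 3), v6–v9 landed references + wave 4, v10 wave 5, v11 final c3: ONE sorry = `stub_superDense`;
c4: v12 = v11 + wave 6 (`stub_catalecticantMaximal`, `stub_partitionRankMaximal`, `stub_fullRankSmallCircuit`,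
`stub_fewLinearForms` — all LANDED) + lead assembly `stub_razDeterminants` (LANDED); v14 = + wave 7
(`stub_affineFormIrreducible`, `stub_sps2NotAnnihilated`, `stub_sps2Hit`, `stub_catalecticantDeterminant`,
`stub_counterexampleProfile` — all LANDED) + assembly `stub_sps2` (LANDED); v16 (this file) = + the lead's
reduction `stub_homogeneousReduction` (crux ⟺ homogeneous level four); heart `stub_superDense` ≡ crux open.
Disproof used: none exists for this crux (no Disproof.lean / Negative lemma, 2026-08-17T11:00Z).
-/

-- layout Summits/ValiantsHypothesis/ValiantsHypothesis forces the duplicated namespace component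
set_option linter.dupNamespace false

namespace Summit.ValiantsHypothesis.ValiantsHypothesis.Cruxes.SuccinctHittingSetsForVP.Birth

open Literature.Barriers.ValiantsHypothesis Literature.Computability.AlgebraicComplexity
open MvPolynomial

/-! ## Wave 1 — LANDED (sparse half) -/

/-- LANDED (c3 wave 1, p152812 `stub_sparse` = `isSuccinctHittingSet_sparse`, from p152268, p152031,
p151912, p151756): `N^a`-sparse polynomials in the coefficient variables are hit by `SmallCircuits ℂ n 4`
eventually in `n`. [ForbesShpilkaVolk2018, Thm. 9 / Cor. 34; status: LANDED] -/
theorem sparse_wave1 :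
    ∀ a : ℕ, ∃ n₀ : ℕ, ∀ n : ℕ, n₀ ≤ n →
      IsSuccinctHittingSet (degLEMonomials n) (SmallCircuits ℂ n 4)
        {D | D.support.card ≤ Nat.choose (2 * n) n ^ a} :=
  Summit.ValiantsHypothesis.ValiantsHypothesis.Theorems.BarrierLever.SuccinctHittingSetsForVP.stub_sparse

/-- LANDED (c3 wave 1, p152812): the crux is equivalent to its dense level-one case `stub_dense`.
[ForbesShpilkaVolk2018, Question 6 and Thm. 9; status: LANDED] -/
theorem crux_iff_dense :
    Summit.ValiantsHypothesis.ValiantsHypothesis.Theses.BarrierLever.SuccinctHittingSetsForVP ↔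
      ∃ b n₀ : ℕ, ∀ n : ℕ, n₀ ≤ n →
        IsSuccinctHittingSet (degLEMonomials n) (SmallCircuits ℂ n b)
          (Distinguishers ℂ n 1 ∩ {D | Nat.choose (2 * n) n < D.support.card}) :=
  Summit.ValiantsHypothesis.ValiantsHypothesis.Theorems.BarrierLever.SuccinctHittingSetsForVP.succinctHittingSetsForVP_iff_dense

/-! ## Wave 2 — the sparse half in generator form (FSV18 Constr. 25/29, Lemma 28/31, Cor. 34) -/

/- WAVE 2 — LANDED (generator form of the sparse half; the four registered stubs, by name):
* `stub_separableCoeff` — p153631, Theorems/BarrierLeverSuccinctHittingSetsForVPStubSeparableCoeff.lean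
  (rank-one coefficient tensors `∏_i c_i(μ_i)` are coefficient vectors of circuits in `SmallCircuits ℂ n 8`;
  FSV Construction 25 / Fact 26 in regime `d = n`);
* `stub_svHit` — p153658, Theorems/BarrierLeverSuccinctHittingSetsForVPStubSvHit.lean (abstract hitting
  lemma of the succinct SV generator, FSV Lemma 28/31);
* `stub_lagrangeIndicator` — p153467, Theorems/BarrierLeverSuccinctHittingSetsForVPStubLagrangeIndicator.lean;
* `stub_generatorGlue` — p153704, Theorems/BarrierLeverSuccinctHittingSetsForVPStubGeneratorGlue.lean
  (∀ a, eventually in n: ∃ t Γ, Γ realisable in `SmallCircuits ℂ n 10` ∧ no nonzero `N^a`-sparse `D`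
  annihilates Γ).
Their composition `sparseProducts_of_generator (stub_generatorGlue stub_separableCoeff stub_svHit
stub_lagrangeIndicator)` is STUB P below; it lands as Theorems/BarrierLeverSuccinctHittingSetsForVPGenerator.lean
(the skeleton cites the four by name only, so that it elaborates on farm nodes that have not yet built them). -/

/-- STUB P (PRODUCTS OF SPARSE POLYNOMIALS ARE HIT — the generator form of the sparse half,
assembled): for every `a`, eventually in `n`, `SmallCircuits ℂ n 10` hits every nonzero finite
product `∏_j E_j` of polynomials `E_j` with at most `N^a` monomials each (depth-3 `ΠΣΠ`
distinguishers with `poly(N)`-sparse factors, in particular `ΠΣ` = products of affine forms of the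
coefficients). It is `sparseProducts_of_generator (stub_generatorGlue stub_separableCoeff stub_svHit
stub_lagrangeIndicator)` (all LANDED in wave 2) and lands as the lead's assembly file
Theorems/BarrierLeverSuccinctHittingSetsForVPGenerator.lean. [ForbesShpilkaVolk2018, Cor. 34;
status: LANDED p155376] -/
theorem stub_sparseProducts :
    ∀ a : ℕ, ∃ n₀ : ℕ, ∀ n : ℕ, n₀ ≤ n →
      IsSuccinctHittingSet (degLEMonomials n) (SmallCircuits ℂ n 10)
        {D | ∃ (k : ℕ) (E : Fin k → MvPolynomial (degLEMonomials n) ℂ),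
          D = ∏ j, E j ∧ ∀ j, (E j).support.card ≤ Nat.choose (2 * n) n ^ a} :=
  -- LANDED: Theorems/BarrierLeverSuccinctHittingSetsForVPGenerator.lean (p155376)
  Summit.ValiantsHypothesis.ValiantsHypothesis.Theorems.BarrierLever.SuccinctHittingSetsForVP.stub_sparseProducts

/-! ## Wave 3 — distinguishers with a LOW-DIMENSIONAL SPACE OF PARTIAL DERIVATIVES are hit
(includes `ΣΛΣ` = sums of powers of affine forms; elementary: low partials ⇒ a low-support monomial) -/

/-- STUB A (dimension of partials vs. minimal support; folklore, cf. the support/rank-concentration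
arguments of Forbes–Saptharishi–Shpilka 2014): if `m` is a monomial of `F` whose support is
inclusion-minimal among the supports of the monomials of `F`, then the `2^|supp m|` iterated partial
derivatives `∂^{m|_T} F` (`T ⊆ supp m`; `∂^v = ` the apolar action of `x^v`) are linearly
independent: in `∂^{m|_T} F` the monomial `x^{m - m|_T}` occurs (from `x^m`), and in a vanishing
combination look at `T₀` of maximal size with nonzero coefficient — any other `T` would need the
monomial `m - m|_{T₀} + m|_T` of support `supp m ∖ (T₀ ∖ T) ⊊ supp m` in `F`. Hence every
finite-dimensional space containing these derivatives has dimension `≥ 2^|supp m|`.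
[folklore; status: LANDED p155871] -/
theorem stub_derivDimension :
    ∀ (ι : Type) [DecidableEq ι] (F : MvPolynomial ι ℂ) (m : ι →₀ ℕ), m ∈ F.support →
      (∀ u ∈ F.support, u.support ⊆ m.support → u.support = m.support) →
      ∀ V : Submodule ℂ (MvPolynomial ι ℂ), FiniteDimensional ℂ V →
        (∀ v : ι →₀ ℕ, v ≤ m → apolarAction (monomial v (1 : ℂ)) F ∈ V) →
        2 ^ m.support.card ≤ Module.finrank ℂ V :=
  -- LANDED: Theorems/BarrierLeverSuccinctHittingSetsForVPStubDerivDimension.lean (p155871)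
  Summit.ValiantsHypothesis.ValiantsHypothesis.Theorems.BarrierLever.SuccinctHittingSetsForVP.stub_derivDimension

/-- STUB B (low partials are hit), CONDITIONAL on STUB A verbatim: if `t(2n+2) ≤ n^b`, the
coefficient vectors of `SmallCircuits ℂ n b` hit every nonzero `D` all of whose partial derivatives
`g ⌟ D` lie in a space of dimension `< 2^(t+1)`: a monomial of `D` with the fewest variables is
support-minimal, has `2^|supp| ≤ dim < 2^(t+1)` by STUB A, so `|supp| ≤ t`, and the landed
`LowSupport.isSuccinctHittingSet_of_small_support` (p147275) hits `D`.
[folklore; status: LANDED p155623] -/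
theorem stub_lowPartialsHit :
    (∀ (ι : Type) [DecidableEq ι] (F : MvPolynomial ι ℂ) (m : ι →₀ ℕ), m ∈ F.support →
      (∀ u ∈ F.support, u.support ⊆ m.support → u.support = m.support) →
      ∀ V : Submodule ℂ (MvPolynomial ι ℂ), FiniteDimensional ℂ V →
        (∀ v : ι →₀ ℕ, v ≤ m → apolarAction (monomial v (1 : ℂ)) F ∈ V) →
        2 ^ m.support.card ≤ Module.finrank ℂ V) →
    ∀ n t b : ℕ, t * (2 * n + 2) ≤ n ^ b →
      IsSuccinctHittingSet (degLEMonomials n) (SmallCircuits ℂ n b)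
        {D | ∃ V : Submodule ℂ (MvPolynomial (degLEMonomials n) ℂ), FiniteDimensional ℂ V ∧
          Module.finrank ℂ V < 2 ^ (t + 1) ∧ ∀ g, apolarAction g D ∈ V} :=
  -- LANDED: Theorems/BarrierLeverSuccinctHittingSetsForVPStubLowPartialsHit.lean (p155623)
  Summit.ValiantsHypothesis.ValiantsHypothesis.Theorems.BarrierLever.SuccinctHittingSetsForVP.stub_lowPartialsHit

/-- STUB C (`ΣΛΣ` has low partials): a sum of `s` powers of affine forms,
`D = Σ_i c_i (a₀ᵢ + Σ_{μ ∈ A} a_{iμ} X_μ)^{d_i}`, has all its partial derivatives `g ⌟ D` inside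
the span of the powers `L_i^j`, `j ≤ d_i` — a space of dimension `≤ Σ_i (d_i + 1)` (the classical
partial-derivative bound for diagonal depth-3 circuits). [folklore (Nisan–Wigderson 1996 style);
status: LANDED p155760] -/
theorem stub_sigmaLambdaSigma :
    ∀ (ι : Type) (s : ℕ) (A : Finset ι) (c a₀ : Fin s → ℂ) (a : Fin s → ι → ℂ) (d : Fin s → ℕ),
      ∃ V : Submodule ℂ (MvPolynomial ι ℂ), FiniteDimensional ℂ V ∧
        Module.finrank ℂ V ≤ ∑ i, (d i + 1) ∧
        ∀ g : MvPolynomial ι ℂ, apolarAction g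
          (∑ i : Fin s, C (c i) * (C (a₀ i) + ∑ μ ∈ A, C (a i μ) * X μ) ^ (d i)) ∈ V :=
  -- LANDED: Theorems/BarrierLeverSuccinctHittingSetsForVPStubSigmaLambdaSigma.lean (p155760)
  Summit.ValiantsHypothesis.ValiantsHypothesis.Theorems.BarrierLever.SuccinctHittingSetsForVP.stub_sigmaLambdaSigma

/-- STUB L (lead assembly of wave 3): for every `a`, eventually in `n`, `SmallCircuits ℂ n 3` hits
every nonzero `D` whose partial derivatives span a space of dimension `≤ N^a` — in particular every
nonzero `ΣΛΣ` distinguisher with `Σ_i (d_i + 1) ≤ N^a` (STUB C); dually, the partial derivatives of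
an equation of `SmallCircuits ℂ n b` span more than `2^(n^(b-2))` dimensions.
[folklore; status: LANDED p156205 (Theorems/…LowPartials.lean)] -/
theorem stub_lowPartials :
    ∀ a : ℕ, ∃ n₀ : ℕ, ∀ n : ℕ, n₀ ≤ n →
      IsSuccinctHittingSet (degLEMonomials n) (SmallCircuits ℂ n 3)
        {D | ∃ V : Submodule ℂ (MvPolynomial (degLEMonomials n) ℂ), FiniteDimensional ℂ V ∧
          Module.finrank ℂ V ≤ Nat.choose (2 * n) n ^ a ∧ ∀ g, apolarAction g D ∈ V} :=
  -- LANDED: Theorems/BarrierLeverSuccinctHittingSetsForVPLowPartials.lean (p156205)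
  Summit.ValiantsHypothesis.ValiantsHypothesis.Theorems.BarrierLever.SuccinctHittingSetsForVP.stub_lowPartials

/-! ## Wave 4 — the sparse half RELATIVE TO THE MULTILINEAR SLICE (FSV18 Thm. 9 in its own,
multilinear, regime: the `P = multilinearSlice` case of the narrowed barrier
`Literature.Barriers.ValiantsHypothesis.AlgebraicNaturalProofsNarrow`, for sparse `𝒟`) -/

/-- STUB M1 (the multilinear all-ones base point): `∏_i (1 + x_i)` is a multilinear small circuit
(size `≤ 2n ≤ n²` for `n ≥ 2`) whose coefficient vector is the indicator of the multilinear
monomials (FSV Construction 29's shift vector `𝟙 = coeff(∏ (x_i + 1))`).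
[ForbesShpilkaVolk2018, Construction 29; status: LANDED p156897] -/
theorem stub_multilinearBase :
    ∀ n : ℕ, 2 ≤ n →
      (∏ i : Fin n, (1 + X i) : MvPolynomial (Fin n) ℂ) ∈ SmallCircuits ℂ n 2 ∧
      (∏ i : Fin n, (1 + X i) : MvPolynomial (Fin n) ℂ) ∈ multilinearSlice ℂ n ∧
      ∀ μ : Fin n →₀ ℕ, MvPolynomial.coeff μ (∏ i : Fin n, (1 + X i) : MvPolynomial (Fin n) ℂ) =
        if ∀ i, μ i ≤ 1 then 1 else 0 :=
  -- LANDED: Theorems/BarrierLeverSuccinctHittingSetsForVPStubMultilinearBase.lean (p156897)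
  Summit.ValiantsHypothesis.ValiantsHypothesis.Theorems.BarrierLever.SuccinctHittingSetsForVP.stub_multilinearBase

/-- STUB M3 (the finite set of multilinear coefficient coordinates): the multilinear exponent
vectors form a `Finset` of `degLEMonomials n` (they have degree `≤ n`). [folklore; status: LANDED p156800] -/
theorem stub_multilinearCoords :
    ∀ n : ℕ, ∃ T : Finset (degLEMonomials n),
      ∀ μ : degLEMonomials n, μ ∈ T ↔ ∀ i, (μ : Fin n →₀ ℕ) i ≤ 1 :=
  -- LANDED: Theorems/BarrierLeverSuccinctHittingSetsForVPStubMultilinearCoords.lean (p156800)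
  Summit.ValiantsHypothesis.ValiantsHypothesis.Theorems.BarrierLever.SuccinctHittingSetsForVP.stub_multilinearCoords

/-- STUB M2 (relative sparse hitting on the multilinear slice, glue; CONDITIONAL on M1 and M3
verbatim): for every `a`, eventually in `n`, every `D` with `≤ N^a` monomials that is nonzero at the
coefficient vector of SOME multilinear polynomial is nonzero at the coefficient vector of a
MULTILINEAR member of `SmallCircuits ℂ n 3` — FSV Thm. 9 (sparse case) as a `multilinearSlice`-relative
succinct hitting set (`IsSuccinctHittingSetRel`). Proof: kill the non-multilinear coordinates
(`D ↦ ρ D`, nonzero by the hypothesis, sparsity does not grow), transport `ρ D` to the polynomial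
ring on the multilinear coordinates `T` (`exists_rename_eq_of_vars_subset_range`), apply FSV
Lemma 32 there with the all-ones shift (`ShiftSmallSupport.exists_narrow_monomial` fed by
`stub_prodSparsity`), take a supported non-root `w` (`LowSupport`), and hit with the multilinear
small circuit `∏(1 + x_i) + Σ_{ν ∈ supp m} w_ν x^ν`. [ForbesShpilkaVolk2018, Thm. 9 / Cor. 34;
status: LANDED p157017] -/
theorem stub_multilinearSparseGlue :
    (∀ n : ℕ, 2 ≤ n →
      (∏ i : Fin n, (1 + X i) : MvPolynomial (Fin n) ℂ) ∈ SmallCircuits ℂ n 2 ∧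
      (∏ i : Fin n, (1 + X i) : MvPolynomial (Fin n) ℂ) ∈ multilinearSlice ℂ n ∧
      ∀ μ : Fin n →₀ ℕ, MvPolynomial.coeff μ (∏ i : Fin n, (1 + X i) : MvPolynomial (Fin n) ℂ) =
        if ∀ i, μ i ≤ 1 then 1 else 0) →
    (∀ n : ℕ, ∃ T : Finset (degLEMonomials n),
      ∀ μ : degLEMonomials n, μ ∈ T ↔ ∀ i, (μ : Fin n →₀ ℕ) i ≤ 1) →
    ∀ a : ℕ, ∃ n₀ : ℕ, ∀ n : ℕ, n₀ ≤ n →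
      IsSuccinctHittingSetRel (degLEMonomials n) (multilinearSlice ℂ n) (SmallCircuits ℂ n 3)
        {D | D.support.card ≤ Nat.choose (2 * n) n ^ a} :=
  -- LANDED: Theorems/BarrierLeverSuccinctHittingSetsForVPStubMultilinearSparseGlue.lean (p157017)
  Summit.ValiantsHypothesis.ValiantsHypothesis.Theorems.BarrierLever.SuccinctHittingSetsForVP.stub_multilinearSparseGlue

/-- STUB M (lead assembly of wave 4): FSV Thm. 9 (sparse case) RELATIVE to the multilinear slice —
`stub_multilinearSparseGlue stub_multilinearBase stub_multilinearCoords`; lands as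
Theorems/BarrierLeverSuccinctHittingSetsForVPMultilinearSparse.lean with the `SuccinctHittingSetsForVPRel`
shape and the "no sparse multilinear-relative natural proof" corollary.
[ForbesShpilkaVolk2018, Thm. 9; status: LANDED p157443] -/
theorem stub_multilinearSparse :
    ∀ a : ℕ, ∃ n₀ : ℕ, ∀ n : ℕ, n₀ ≤ n →
      IsSuccinctHittingSetRel (degLEMonomials n) (multilinearSlice ℂ n) (SmallCircuits ℂ n 3)
        {D | D.support.card ≤ Nat.choose (2 * n) n ^ a} :=
  -- LANDED: Theorems/BarrierLeverSuccinctHittingSetsForVPMultilinearSparse.lean (p157443)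
  Summit.ValiantsHypothesis.ValiantsHypothesis.Theorems.BarrierLever.SuccinctHittingSetsForVP.stub_multilinearSparse

/-! ## Wave 5 — THE PARTIAL-DERIVATIVE MEASURE IS MAXIMAL ON SMALL CIRCUITS (Nisan–Wigderson's
order-`k` partial-derivative rank attains its generic value `C(n+k-1, k)` on `SmallCircuits ℂ n 8`, all
`k ≤ n/2`: the rank method of partial derivatives — catalogued in
`Literature.Barriers.ValiantsHypothesis.RankMethods` — cannot be an algebraically natural proof against
`VP` in the regime `d = n`, as the crux predicts) -/

/-- STUB PD1 (rising-factorial finite differences are diagonal on a degree slice): for exponent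
vectors `u, v` of the same degree, the `v`-th iterated forward difference at `0` of
`w ↦ ∏_i (w_i + u_i)! / w_i!` (a polynomial of multidegree `u`) is `∏_i u_i!` if `u = v` and `0`
otherwise (some `v_i > u_i` kills the `i`-th factor: the `v_i`-th difference of a degree-`u_i`
polynomial). Univariate core: `Σ_{j ≤ b} (-1)^{b-j} C(b,j) C(j+a, a) = C(a, b)`.
[folklore; status: LANDED p158170] -/
theorem stub_risingDiagonal :
    ∀ (n : ℕ) (u v : Fin n →₀ ℕ), u.degree = v.degree →
      (∑ w ∈ Finset.Iic v, (-1 : ℂ) ^ (v - w).degree *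
          (∏ i, (Nat.choose (v i) (w i) : ℂ)) * ∏ i, (Nat.descFactorial (w i + u i) (u i) : ℂ)) =
        if u = v then ∏ i, ((u i).factorial : ℂ) else 0 :=
  -- LANDED: Theorems/BarrierLeverSuccinctHittingSetsForVPStubRisingDiagonal.lean (p158170)
  Summit.ValiantsHypothesis.ValiantsHypothesis.Theorems.BarrierLever.SuccinctHittingSetsForVP.stub_risingDiagonal

/-- STUB PD2 (order-`k` partials of the all-ones polynomial are independent), CONDITIONAL on PD1
verbatim: if every coefficient of `f` in degree `≤ n` equals `1` and `2k ≤ n`, the partial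
derivatives `∂^u f = x^u ⌟ f`, `|u| = k`, are linearly independent — apply the signed sums of PD1 to
the coefficients `coeff_w (∂^u f) = ∏_i (w_i+u_i)!/w_i!` (`|w| ≤ k`, landed
`DerivDimension.coeff_apolarAction_monomial_one`) of a vanishing combination.
[folklore; status: LANDED p158066] -/
theorem stub_partialsIndependent :
    (∀ (n : ℕ) (u v : Fin n →₀ ℕ), u.degree = v.degree →
      (∑ w ∈ Finset.Iic v, (-1 : ℂ) ^ (v - w).degree *
          (∏ i, (Nat.choose (v i) (w i) : ℂ)) * ∏ i, (Nat.descFactorial (w i + u i) (u i) : ℂ)) =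
        if u = v then ∏ i, ((u i).factorial : ℂ) else 0) →
    ∀ (n k : ℕ) (f : MvPolynomial (Fin n) ℂ), 2 * k ≤ n →
      (∀ m : Fin n →₀ ℕ, m.degree ≤ n → MvPolynomial.coeff m f = 1) →
      LinearIndependent ℂ
        (fun u : {u : Fin n →₀ ℕ // u.degree = k} => apolarAction (monomial u.1 (1 : ℂ)) f) :=
  -- LANDED: Theorems/BarrierLeverSuccinctHittingSetsForVPStubPartialsIndependent.lean (p158066)
  Summit.ValiantsHypothesis.ValiantsHypothesis.Theorems.BarrierLever.SuccinctHittingSetsForVP.stub_partialsIndependent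

/-- STUB PD3 (lead assembly): for `n ≥ 8` some `f ∈ SmallCircuits ℂ n 8` — the all-ones polynomial
`Σ_{|m| ≤ n} x^m`, from `stub_separableCoeff` with `c ≡ 1` — has linearly independent order-`k`
partial derivatives for every `k ≤ n/2`: the partial-derivative measure is MAXIMAL (`= C(n+k-1,k)`)
on small circuits. [folklore; status: LANDED p158554 (Theorems/…PartialsMaximal.lean)] -/
theorem stub_partialsMaximal :
    ∀ n : ℕ, 8 ≤ n → ∃ f ∈ SmallCircuits ℂ n 8, ∀ k : ℕ, 2 * k ≤ n →
      LinearIndependent ℂ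
        (fun u : {u : Fin n →₀ ℕ // u.degree = k} => apolarAction (monomial u.1 (1 : ℂ)) f) :=
  -- LANDED: Theorems/BarrierLeverSuccinctHittingSetsForVPPartialsMaximal.lean (p158554)
  Summit.ValiantsHypothesis.ValiantsHypothesis.Theorems.BarrierLever.SuccinctHittingSetsForVP.stub_partialsMaximal

/-! ## Wave 6 (lead c4) — the remaining RANK METHODS of the catalogue are maximal on small circuits,
and distinguishers with few ESSENTIAL VARIABLES are hit

FSV18 §1.2 lists the rank methods that are algebraically natural: partial derivatives (wave 5),
coefficient / evaluation dimension for a variable partition, catalecticant (coefficient) matrices,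
and — in the multilinear world — Raz's min-partition rank. Each stub below says: the measure attains
its generic maximum on an explicit member of `SmallCircuits`, so no threshold of the method is an
equation for `VP` in regime `d = n` (unconditionally, as the crux predicts). -/

/-- STUB CAT (Sylvester's catalecticant / coefficient matrix is maximal on small circuits): for
`n ≥ 8` some `f ∈ SmallCircuits ℂ n 8` has, for every `k ≤ n/2`, a coefficient matrix
`Cat_k(f)[u, w] = coeff_{u+w} f` (rows `|u| = k`, columns `|w| ≤ n - k`) with linearly independent
rows (full row rank `C(n+k-1, k)`). Witness: `f = Σ_{|m| ≤ n} (∏_i m_i!) x^m` (separable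
coefficients, `stub_separableCoeff` p153631 with `c_i(j) = j!`); then
`Cat_k(f)[u, w] = ∏_i (u_i + w_i)! = (∏_i w_i!) · coeff_w(x^u ⌟ g)` for the all-ones polynomial `g`,
so row independence is `stub_partialsIndependent` (p158066) after an invertible column scaling.
[folklore (Sylvester 1852; Iarrobino–Kanev 1999 §1); status: LANDED p161094] -/
theorem stub_catalecticantMaximal :
    ∀ n : ℕ, 8 ≤ n → ∃ f ∈ SmallCircuits ℂ n 8, ∀ k : ℕ, 2 * k ≤ n →
      LinearIndependent ℂ
        (fun u : {u : Fin n →₀ ℕ // u.degree = k} =>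
          fun w : {w : Fin n →₀ ℕ // w.degree ≤ n - k} => MvPolynomial.coeff (u.1 + w.1) f) :=
  -- LANDED: Theorems/BarrierLeverSuccinctHittingSetsForVPStubCatalecticantMaximal.lean (p161094)
  Summit.ValiantsHypothesis.ValiantsHypothesis.Theorems.BarrierLever.SuccinctHittingSetsForVP.stub_catalecticantMaximal

/-- STUB PART (the coefficient matrix of a variable partition is maximal on small circuits; Nisan 1991 /
evaluation dimension): for `n ≥ 2`, `2h ≤ n`, `2k ≤ n`, some `f ∈ SmallCircuits ℂ n 2` has a
partition coefficient matrix `M[p, q] = coeff_{p+q} f` — rows: monomials `p` in the first `h`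
variables of degree `≤ k`; columns: monomials `q` in the remaining variables of degree `≤ n - k` —
with linearly independent rows. Witness: `f = Σ_{d ≤ k} (Σ_{i < h} x_i x_{h+i})^d` (size `≤ 2h + 2k`,
degree `≤ 2k ≤ n`): `M[p, q] ≠ 0` iff `q` is the copy of `p` on the paired variables, a monomial
matrix. (One partition per `h` suffices for the method: `SmallCircuits` is invariant under renaming
the variables, `complexity_rename_of_injective`.) [folklore (Nisan 1991; Raz 2009 §1); status: LANDED p161911] -/
theorem stub_partitionRankMaximal :
    ∀ n h k : ℕ, 2 ≤ n → 2 * h ≤ n → 2 * k ≤ n → ∃ f ∈ SmallCircuits ℂ n 2,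
      LinearIndependent ℂ
        (fun p : {p : Fin n →₀ ℕ // (∀ i ∈ p.support, (i : ℕ) < h) ∧ p.degree ≤ k} =>
          fun q : {q : Fin n →₀ ℕ // (∀ i ∈ q.support, h ≤ (i : ℕ)) ∧ q.degree ≤ n - k} =>
            MvPolynomial.coeff (p.1 + q.1) f) :=
  -- LANDED: Theorems/BarrierLeverSuccinctHittingSetsForVPStubPartitionRankMaximal.lean (p161911)
  Summit.ValiantsHypothesis.ValiantsHypothesis.Theorems.BarrierLever.SuccinctHittingSetsForVP.stub_partitionRankMaximal

/-- STUB RAZ (Raz's full-rank method is maximal on small circuits OVER `ℂ`): for `n ≥ 2` some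
`f ∈ SmallCircuits ℂ (2n) 4` is of FULL RANK in Raz's sense — for EVERY balanced partition of the
`2n` variables into `Y ⊔ Z` the `2^n × 2^n` multilinear coefficient matrix has rank `2^n`
(`Literature.Barriers.ValiantsHypothesis.IsFullRank`). Source: the Raz–Yehudayoff polynomial is of
full rank over `ℂ(W)` (tree: `RazYehudayoff2008_thm42_holds`, effective form `RazYehudayoff.core_all`)
and is computed by the fan-in-two circuit `RazYehudayoff.ryCircuit` of size `≤ 6(n³+1) ≤ (2n)^4`
for ANY specialisation `c` of the auxiliary variables (`eval_ryCircuit`, `size_ryCircuit_le`,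
`isFanInTwo_ryCircuit`); specialise `W ↦ w ∈ ℂ^{W}` outside the zero set of the product over all
partitions `A` of `det M_{f^A} ∈ ℂ[W] ∖ {0}` (`det_cM_map_rename`, `MvPolynomial.funext`), and bound
`totalDegree ≤ 2n` by induction along `ryFc_succ` (even lengths). [RazYehudayoff2008 Thm. 4.2 / 4.4;
status: LANDED p161281] -/
theorem stub_fullRankSmallCircuit :
    ∀ n : ℕ, 2 ≤ n → ∃ f ∈ SmallCircuits ℂ (2 * n) 4,
      Literature.Barriers.ValiantsHypothesis.IsFullRank n f :=
  -- LANDED: Theorems/BarrierLeverSuccinctHittingSetsForVPStubFullRankSmallCircuit.lean (p161281)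
  Summit.ValiantsHypothesis.ValiantsHypothesis.Theorems.BarrierLever.SuccinctHittingSetsForVP.stub_fullRankSmallCircuit

/-- STUB ESS (distinguishers with few ESSENTIAL VARIABLES are hit, whatever their degree and size):
if `t (2n+2) ≤ n^b`, the coefficient vectors of `SmallCircuits ℂ n b` hit every nonzero `D` that is a
polynomial `G(ℓ_1, …, ℓ_t)` in `t` affine forms `ℓ_j` of the coefficient variables (Carlini 2006:
`D` has `≤ t` essential variables). Proof: the columns of the linear part of `ℓ` are spanned by `≤ t`
of them (coordinates `T`); a non-root `c₀` of `D` (`MvPolynomial.funext`) is matched on `ℓ` by a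
vector `c₁` supported on `T`, so `D(c₁) = G(ℓ(c₁)) = G(ℓ(c₀)) ≠ 0`, and `c₁ = coeff(Σ_{μ ∈ T} c₁(μ) x^μ)`
with `Σ_{μ ∈ T} c₁(μ) x^μ ∈ SmallCircuits ℂ n b` (`LowDegree.sparse_mem_smallCircuits`,
`LowDegree.coeffVector_sparse`). Not covered by `stub_lowPartials` (the partials of `G(ℓ)` span up to
`C(t + deg D, t)` dimensions). [folklore (Carlini 2006, essential variables); status: LANDED p161431] -/
theorem stub_fewLinearForms :
    ∀ n t b : ℕ, t * (2 * n + 2) ≤ n ^ b →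
      IsSuccinctHittingSet (degLEMonomials n) (SmallCircuits ℂ n b)
        {D | ∃ (ℓ : Fin t → MvPolynomial (degLEMonomials n) ℂ) (G : MvPolynomial (Fin t) ℂ),
          (∀ j, (ℓ j).totalDegree ≤ 1) ∧ D = MvPolynomial.aeval ℓ G} :=
  -- LANDED: Theorems/BarrierLeverSuccinctHittingSetsForVPStubFewLinearForms.lean (p161431)
  Summit.ValiantsHypothesis.ValiantsHypothesis.Theorems.BarrierLever.SuccinctHittingSetsForVP.stub_fewLinearForms

/-! ## Wave 7 (lead c4) — `ΣΠΣ(2)` DISTINGUISHERS (a sum of two products of affine forms of the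
coefficients, any number of factors, any size) ARE HIT; Sylvester's catalecticant DETERMINANT is hit;
the profile of a counterexample

The two-seed separable generator `Γ₂ : c_μ ↦ y₁ s₁^μ + y₂ s₂^μ` (seeds `y : Fin 2`, `s : Fin 2 × Fin n`;
every value is the coefficient vector of `y₁ Λ_{s₁} + y₂ Λ_{s₂} ∈ SmallCircuits ℂ n 9`,
`Λ_s = Σ_{|m| ≤ n} s^m x^m` from `stub_separableCoeff`) maps a non-constant affine form
`ℓ = a₀ + Σ a_μ c_μ` to `a₀ + y₁ P_ℓ(s₁) + y₂ P_ℓ(s₂)`, `P_ℓ(s) = Σ a_μ s^μ ≠ 0`, which is IRREDUCIBLE in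
the UFD `ℂ[y, s]` and determines `ℓ`; unique factorisation then shows that no nonzero
`D = a Πℓ_i + b Πℓ'_j` annihilates `Γ₂` (the `k = 2` case of the rank-bound PIT for `ΣΠΣ(k)`,
Dvir–Shpilka / Kayal–Saraf / Saxena–Seshadhri, needs no rank bound). -/

/-- STUB SPS-A (affine forms become irreducible under the two-seed separable generator): for every
affine form `ℓ` of the coefficient variables with `totalDegree ℓ = 1` (non-constant), its image
`a₀ + y₁ P_ℓ(s₁) + y₂ P_ℓ(s₂)` under `Γ₂` is irreducible in `ℂ[y₁, y₂, s₁, s₂]`: a factorisation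
`h · k` has, by `y₁`- and `y₂`-degrees, a factor free of `y₁`; if it is also free of `y₂` it divides
`P_ℓ(s₁) ∈ ℂ[s₁]`, `P_ℓ(s₂) ∈ ℂ[s₂]` and is a constant; otherwise comparing the coefficients of
`y₁ y₂` and `y₁` forces `P_ℓ = 0`. [folklore (Gauss lemma); status: LANDED p163609] -/
theorem stub_affineFormIrreducible :
    ∀ (n : ℕ) (ℓ : MvPolynomial (degLEMonomials n) ℂ), ℓ.totalDegree = 1 →
      Irreducible (MvPolynomial.aeval
        (fun μ : degLEMonomials n => ∑ r : Fin 2,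
            (X (Sum.inl r) : MvPolynomial (Fin 2 ⊕ (Fin 2 × Fin n)) ℂ) *
              ∏ i : Fin n, X (Sum.inr (r, i)) ^ (μ : Fin n →₀ ℕ) i) ℓ) :=
  -- LANDED: Theorems/BarrierLeverSuccinctHittingSetsForVPStubAffineFormIrreducible.lean (p163609)
  Summit.ValiantsHypothesis.ValiantsHypothesis.Theorems.BarrierLever.SuccinctHittingSetsForVP.stub_affineFormIrreducible

/-- STUB SPS-B (`ΣΠΣ(2)` does not annihilate `Γ₂`), CONDITIONAL on STUB SPS-A verbatim: if
`D = a ∏_i ℓ_i + b ∏_j ℓ'_j ≠ 0` with non-constant affine forms `ℓ_i, ℓ'_j`, then `D ∘ Γ₂ ≠ 0`.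
Proof: if `a ∏ (ℓ_i∘Γ₂) = -b ∏ (ℓ'_j∘Γ₂)` with `a, b ≠ 0`, unique factorisation in the UFD
`MvPolynomial _ ℂ` (`UniqueFactorizationMonoid.factors_unique`) matches the irreducibles `ℓ_i∘Γ₂` with
the `ℓ'_j∘Γ₂` up to units (= nonzero constants, `MvPolynomial.isUnit_iff_eq_C_of_isReduced`), and
`Γ₂` is injective on affine forms (the monomials `y₁ s₁^μ` are distinct), so `ℓ_i = u_i ℓ'_{πi}`,
`∏ ℓ_i = κ ∏ ℓ'_j`, `D = (aκ + b) ∏ ℓ'_j` and `D ∘ Γ₂ = 0` forces `aκ + b = 0`, i.e. `D = 0`.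
[folklore (the `k = 2` case of `ΣΠΣ(k)` identity testing); status: LANDED p163442] -/
theorem stub_sps2NotAnnihilated :
    (∀ (n : ℕ) (ℓ : MvPolynomial (degLEMonomials n) ℂ), ℓ.totalDegree = 1 →
      Irreducible (MvPolynomial.aeval
        (fun μ : degLEMonomials n => ∑ r : Fin 2,
            (X (Sum.inl r) : MvPolynomial (Fin 2 ⊕ (Fin 2 × Fin n)) ℂ) *
              ∏ i : Fin n, X (Sum.inr (r, i)) ^ (μ : Fin n →₀ ℕ) i) ℓ)) →
    ∀ (n p q : ℕ) (a b : ℂ) (ℓ : Fin p → MvPolynomial (degLEMonomials n) ℂ)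
      (ℓ' : Fin q → MvPolynomial (degLEMonomials n) ℂ),
      (∀ i, (ℓ i).totalDegree = 1) → (∀ j, (ℓ' j).totalDegree = 1) →
      C a * ∏ i, ℓ i + C b * ∏ j, ℓ' j ≠ 0 →
      MvPolynomial.aeval
        (fun μ : degLEMonomials n => ∑ r : Fin 2,
            (X (Sum.inl r) : MvPolynomial (Fin 2 ⊕ (Fin 2 × Fin n)) ℂ) *
              ∏ i : Fin n, X (Sum.inr (r, i)) ^ (μ : Fin n →₀ ℕ) i)
        (C a * ∏ i, ℓ i + C b * ∏ j, ℓ' j) ≠ 0 :=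
  -- LANDED: Theorems/BarrierLeverSuccinctHittingSetsForVPStubSps2NotAnnihilated.lean (p163442)
  Summit.ValiantsHypothesis.ValiantsHypothesis.Theorems.BarrierLever.SuccinctHittingSetsForVP.stub_sps2NotAnnihilated

/-- STUB SPS-C (`ΣΠΣ(2)` distinguishers are hit), CONDITIONAL on the conclusion of STUB SPS-B
verbatim: for `n ≥ 8`, `SmallCircuits ℂ n 9` hits every nonzero `D = a ∏_i ℓ_i + b ∏_j ℓ'_j`
(non-constant affine forms `ℓ_i, ℓ'_j` of the coefficient variables; any number of factors, any
size) — the generator principle `Generator.exists_mem_smallCircuits_of_aeval_ne_zero` (p155376) with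
`Γ₂` realised by `y₁ Λ_{s₁} + y₂ Λ_{s₂}`, `Λ_s ∈ SmallCircuits ℂ n 8` from `stub_separableCoeff`
(p153631) with `c_i(j) = s_i^j` (size `2 n^8 + 3 ≤ n^9`). [folklore; status: LANDED p163305] -/
theorem stub_sps2Hit :
    (∀ (n p q : ℕ) (a b : ℂ) (ℓ : Fin p → MvPolynomial (degLEMonomials n) ℂ)
      (ℓ' : Fin q → MvPolynomial (degLEMonomials n) ℂ),
      (∀ i, (ℓ i).totalDegree = 1) → (∀ j, (ℓ' j).totalDegree = 1) →
      C a * ∏ i, ℓ i + C b * ∏ j, ℓ' j ≠ 0 →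
      MvPolynomial.aeval
        (fun μ : degLEMonomials n => ∑ r : Fin 2,
            (X (Sum.inl r) : MvPolynomial (Fin 2 ⊕ (Fin 2 × Fin n)) ℂ) *
              ∏ i : Fin n, X (Sum.inr (r, i)) ^ (μ : Fin n →₀ ℕ) i)
        (C a * ∏ i, ℓ i + C b * ∏ j, ℓ' j) ≠ 0) →
    ∀ n : ℕ, 8 ≤ n →
      IsSuccinctHittingSet (degLEMonomials n) (SmallCircuits ℂ n 9)
        {D | ∃ (p q : ℕ) (a b : ℂ) (ℓ : Fin p → MvPolynomial (degLEMonomials n) ℂ)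
          (ℓ' : Fin q → MvPolynomial (degLEMonomials n) ℂ),
          (∀ i, (ℓ i).totalDegree = 1) ∧ (∀ j, (ℓ' j).totalDegree = 1) ∧
          D = C a * ∏ i, ℓ i + C b * ∏ j, ℓ' j} :=
  -- LANDED: Theorems/BarrierLeverSuccinctHittingSetsForVPStubSps2Hit.lean (p163305)
  Summit.ValiantsHypothesis.ValiantsHypothesis.Theorems.BarrierLever.SuccinctHittingSetsForVP.stub_sps2Hit

/-- STUB SPS2 (lead assembly of wave 7 — `ΣΠΣ(2)` DISTINGUISHERS ARE HIT, unconditional): for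
`n ≥ 8`, `SmallCircuits ℂ n 9` hits every nonzero `a ∏ ℓ_i + b ∏ ℓ'_j` with non-constant affine forms
`ℓ_i, ℓ'_j` of the coefficient variables = `stub_sps2Hit (stub_sps2NotAnnihilated stub_affineFormIrreducible)`;
lands as Theorems/BarrierLeverSuccinctHittingSetsForVPSps2.lean with `levelOne_sps2`,
`not_isNaturalProof_sps2`, `isSuccinctHittingSet_prodAffine`, `isSuccinctHittingSet_twoByTwoAffine`.
[ForbesShpilkaVolk2018 §3 / Question 6; status: LANDED p164336] -/
theorem stub_sps2 :
    ∀ n : ℕ, 8 ≤ n →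
      IsSuccinctHittingSet (degLEMonomials n) (SmallCircuits ℂ n 9)
        {D | ∃ (p q : ℕ) (a b : ℂ) (ℓ : Fin p → MvPolynomial (degLEMonomials n) ℂ)
          (ℓ' : Fin q → MvPolynomial (degLEMonomials n) ℂ),
          (∀ i, (ℓ i).totalDegree = 1) ∧ (∀ j, (ℓ' j).totalDegree = 1) ∧
          D = C a * ∏ i, ℓ i + C b * ∏ j, ℓ' j} :=
  -- LANDED: Theorems/BarrierLeverSuccinctHittingSetsForVPSps2.lean (p164336)
  Summit.ValiantsHypothesis.ValiantsHypothesis.Theorems.BarrierLever.SuccinctHittingSetsForVP.stub_sps2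

/-- STUB CATDET (Sylvester's catalecticant DETERMINANT is hit): for `n ≥ 8` some
`f ∈ SmallCircuits ℂ n 8` has, for every `k ≤ n/2`, a NONSINGULAR square catalecticant block
`[coeff_{u+w} f]_{|u| = |w| = k}` (for any enumeration of the rows). Witness: `f = Σ (∏ m_i!) x^m`
(`CatalecticantMaximal.exists_factorial_mem_smallCircuits`, p161094): the block is
`R[u, w] = ∏_i (u_i + w_i)!`, a principal submatrix of the `n`-fold Kronecker power of the Hankel
moment matrix `H[a, b] = (a+b)! = ∫_0^∞ x^{a+b} e^{-x} dx` of the Laguerre weight, hence POSITIVE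
DEFINITE (Gram matrix of distinct monomials), so `det R ≠ 0`. [folklore (Sylvester 1852; Stieltjes
moment matrices); status: LANDED p163487] -/
theorem stub_catalecticantDeterminant :
    ∀ n : ℕ, 8 ≤ n → ∃ f ∈ SmallCircuits ℂ n 8, ∀ (k : ℕ) [Fintype {u : Fin n →₀ ℕ // u.degree = k}],
      2 * k ≤ n →
        (Matrix.of fun u w : {u : Fin n →₀ ℕ // u.degree = k} =>
          MvPolynomial.coeff (u.1 + w.1) f).det ≠ 0 :=
  -- LANDED: Theorems/BarrierLeverSuccinctHittingSetsForVPStubCatalecticantDeterminant.lean (p163487)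
  Summit.ValiantsHypothesis.ValiantsHypothesis.Theorems.BarrierLever.SuccinctHittingSetsForVP.stub_catalecticantDeterminant

/-- STUB PROFILE (lead; the profile of a counterexample, one statement): for `n ≥ 4`, `b ≥ 4`, an
algebraically natural proof `D` against `SmallCircuits ℂ n b` (FSV Def. 1, ANY class `𝒟`) has degree
`> n^(b-2)` (p146310), every monomial wider than `n^(b-2)` (p147275), more than `2^(n^(b-3))` monomials
(p152812), a space of partial derivatives of dimension `> 2^(n^(b-2))` (p156205), and more than
`n^b / (2n+2)` essential variables (p161431). [ForbesShpilkaVolk2018 Def. 1; status: LANDED p163202] -/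
theorem stub_counterexampleProfile :
    ∀ n b : ℕ, 4 ≤ n → 4 ≤ b →
      ∀ (𝒟 : Set (MvPolynomial (degLEMonomials n) ℂ)) (D : MvPolynomial (degLEMonomials n) ℂ),
        IsNaturalProof (degLEMonomials n) (SmallCircuits ℂ n b) 𝒟 D →
          n ^ (b - 2) < D.totalDegree ∧
          (∀ m ∈ D.support, n ^ (b - 2) < m.support.card) ∧
          2 ^ (n ^ (b - 3)) < D.support.card ∧
          (∀ V : Submodule ℂ (MvPolynomial (degLEMonomials n) ℂ), FiniteDimensional ℂ V →
            (∀ g, apolarAction g D ∈ V) → 2 ^ (n ^ (b - 2)) < Module.finrank ℂ V) ∧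
          (∀ (t : ℕ) (ℓ : Fin t → MvPolynomial (degLEMonomials n) ℂ) (G : MvPolynomial (Fin t) ℂ),
            (∀ j, (ℓ j).totalDegree ≤ 1) → D = MvPolynomial.aeval ℓ G → n ^ b < t * (2 * n + 2)) :=
  -- LANDED: Theorems/BarrierLeverSuccinctHittingSetsForVPStubCounterexampleProfile.lean (p163202)
  Summit.ValiantsHypothesis.ValiantsHypothesis.Theorems.BarrierLever.SuccinctHittingSetsForVP.stub_counterexampleProfile

/-- STUB RAZDET (lead assembly of wave 6 — RAZ'S DETERMINANTS ARE HIT): for `n ≥ 2` the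
coefficient vectors of `SmallCircuits ℂ (2n) 4` hit every polynomial in the `C(4n,2n)` coefficient
variables whose value at every coefficient vector is Raz's determinant `det M_{f^A}` for some balanced
partition `A` — these are level-4 distinguishers for `n ≥ 10` (Berkowitz: size `≤ 8(2^n+1)^7 ≤ N^4`),
the classical natural proofs against multilinear formulas; from STUB RAZ (`stub_fullRankSmallCircuit`).
Lands as Theorems/BarrierLeverSuccinctHittingSetsForVPRazDeterminant.lean with
`razDet_mem_distinguishers`, `razDet_hit`, `not_isNaturalProof_razDeterminant`.
[ForbesShpilkaVolk2018 Question 6 / §1.2; RazYehudayoff2008 Thm. 4.2; status: LANDED p162627] -/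
theorem stub_razDeterminants :
    ∀ n : ℕ, 2 ≤ n →
      IsSuccinctHittingSet (degLEMonomials (2 * n)) (SmallCircuits ℂ (2 * n) 4)
        {D | ∃ A : Fin (2 * n) ≃ Fin n ⊕ Fin n, ∀ f : MvPolynomial (Fin (2 * n)) ℂ,
          MvPolynomial.eval (coeffVector (degLEMonomials (2 * n)) f) D =
            (Literature.Barriers.ValiantsHypothesis.pdMatrix (MvPolynomial.rename A f)).det} :=
  -- LANDED: Theorems/BarrierLeverSuccinctHittingSetsForVPRazDeterminant.lean (p162627)
  Summit.ValiantsHypothesis.ValiantsHypothesis.Theorems.BarrierLever.SuccinctHittingSetsForVP.stub_razDeterminants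

/-! ## The dense half (open heart) and the landed level collapse -/

/-- STUB HOM (lead c4 — REDUCTION OF THE HEART TO HOMOGENEOUS DISTINGUISHERS): if for some `b`,
eventually in `n`, `SmallCircuits ℂ n b` hits every nonzero HOMOGENEOUS level-4 distinguisher, then
level one holds (size exponent `b + 1`): a level-one equation `D` for `SmallCircuits ℂ n (b+1)` has a
nonzero homogeneous component `D_j`, which vanishes on `SmallCircuits ℂ n b` (restrict `D` to the line
`t ↦ t • coeff f = coeff (C t * f)`; a nonzero univariate polynomial over `ℂ` has a non-root) and is a
level-4 distinguisher by Strassen's homogenisation (`complexity_homogeneousComponent_le_sq_mul`: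
`L(D_j) ≤ (j+2)² L(D) ≤ (N+2)² N ≤ N⁴`). With `succinctHittingSetsForVP_iff_levelOne`: crux ⟺
homogeneous level four (`succinctHittingSetsForVP_iff_homogeneous`). Lands as
Theorems/BarrierLeverSuccinctHittingSetsForVPHomogeneous.lean.
[ForbesShpilkaVolk2018 Question 6; BCS (7.1); status: LANDED p164794] -/
theorem stub_homogeneousReduction :
    (∃ b n₀ : ℕ, ∀ n : ℕ, n₀ ≤ n →
      IsSuccinctHittingSet (degLEMonomials n) (SmallCircuits ℂ n b)
        (Distinguishers ℂ n 4 ∩ {D | D.IsHomogeneous D.totalDegree})) →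
    ∃ b n₀ : ℕ, ∀ n : ℕ, n₀ ≤ n →
      IsSuccinctHittingSet (degLEMonomials n) (SmallCircuits ℂ n b) (Distinguishers ℂ n 1) :=
  -- LANDED: Theorems/BarrierLeverSuccinctHittingSetsForVPHomogeneous.lean (p164794)
  Summit.ValiantsHypothesis.ValiantsHypothesis.Theorems.BarrierLever.SuccinctHittingSetsForVP.stub_homogeneousReduction

/-- STUB R (reduction to the SUPER-DENSE case; lead, lands as
Theorems/BarrierLeverSuccinctHittingSetsForVPSuperDense.lean): if for some `b`, eventually in `n`,
`SmallCircuits ℂ n b` hits the level-one distinguishers with MORE than `2^(n^(b-3))` monomials, then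
level one holds — because the very same size budget `n^b` already hits every distinguisher with at
most `2^(n^(b-3))` monomials (sparse master theorem `Sparse.isSuccinctHittingSet_card_support_lt_of_le`
with `t = n^(b-3)`, landed p152812). Supersedes the wave-1 split at threshold `N`
(`crux_iff_dense`). [ForbesShpilkaVolk2018, Question 6 and Cor. 34; status: LANDED p154735] -/
theorem stub_levelOneOfSuperDense :
    (∃ b n₀ : ℕ, ∀ n : ℕ, n₀ ≤ n →
      IsSuccinctHittingSet (degLEMonomials n) (SmallCircuits ℂ n b)
        (Distinguishers ℂ n 1 ∩ {D | 2 ^ (n ^ (b - 3)) < D.support.card})) →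
    ∃ b n₀ : ℕ, ∀ n : ℕ, n₀ ≤ n →
      IsSuccinctHittingSet (degLEMonomials n) (SmallCircuits ℂ n b) (Distinguishers ℂ n 1) :=
  -- LANDED: Theorems/BarrierLeverSuccinctHittingSetsForVPSuperDense.lean (p154735)
  Summit.ValiantsHypothesis.ValiantsHypothesis.Theorems.BarrierLever.SuccinctHittingSetsForVP.stub_levelOneOfSuperDense

/-! ## Wave 8 (lead c4) — the `|μ|`-ISOBARIC reduction of the heart; Nisan's partition DETERMINANTS are hit
level-8 distinguishers -/

/-- STUB ISO (equations may be assumed BIHOMOGENEOUS — homogeneous in the coefficient variables AND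
isobaric for the weight `c_μ ↦ |μ|` — and super-dense): if for some `b`, eventually in `n`,
`SmallCircuits ℂ n b` hits every nonzero distinguisher of level `16` that is homogeneous, isobaric for
the weight `w(μ) = |μ|` (some weight `k`) and has more than `2^(n^(b-3))` monomials, then for some
`b'`, eventually, it hits every nonzero HOMOGENEOUS level-4 distinguisher (the hypothesis of
`stub_homogeneousReduction`). Mechanism (mirror of `Homogeneous`/`Heart`, p164794/p165233, with the
scaling of the VARIABLES `x ↦ t x`, `coeff_μ f(tx) = t^|μ| coeff_μ f`, `L(f(tx)) ≤ L(f) + n` by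
`complexity_aeval_le`): a homogeneous level-4 equation `E` (degree `d`) for `SmallCircuits ℂ n (b+1)`
has all its isobaric components `E^(k)` vanishing on `SmallCircuits ℂ n b`; a nonzero one is
homogeneous, isobaric, an equation (hence super-dense, `Sparse.two_pow_pow_lt_card_support_of_vanishes`),
and of level 16 because `E^(k) = (homogeneousComponent (d+k) Ẽ)|_(s=1)` for
`Ẽ = E(c_μ s^|μ|)` (one auxiliary variable `s`; Strassen homogenisation
`complexity_homogeneousComponent_le_sq_mul`, `complexity_aeval_le`). [ForbesShpilkaVolk2018 Question 6;
BCS (7.1); status: LANDED p167193] -/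
theorem stub_isobaricReduction :
    (∃ b n₀ : ℕ, ∀ n : ℕ, n₀ ≤ n →
      IsSuccinctHittingSet (degLEMonomials n) (SmallCircuits ℂ n b)
        (Distinguishers ℂ n 16 ∩ {D | D.IsHomogeneous D.totalDegree} ∩
          {D | ∃ k : ℕ, D.IsWeightedHomogeneous (fun μ : degLEMonomials n => (μ : Fin n →₀ ℕ).degree) k} ∩
          {D | 2 ^ (n ^ (b - 3)) < D.support.card})) →
    ∃ b n₀ : ℕ, ∀ n : ℕ, n₀ ≤ n →
      IsSuccinctHittingSet (degLEMonomials n) (SmallCircuits ℂ n b)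
        (Distinguishers ℂ n 4 ∩ {D | D.IsHomogeneous D.totalDegree}) :=
  -- LANDED: Theorems/BarrierLeverSuccinctHittingSetsForVPStubIsobaricReduction.lean (p167193)
  Summit.ValiantsHypothesis.ValiantsHypothesis.Theorems.BarrierLever.SuccinctHittingSetsForVP.stub_isobaricReduction

/-- STUB NISAN-HIT (Nisan's balanced partition determinants are hit): for `n ≥ 2`, `2h ≤ n`, and any
bijection `e` between the monomials `p` in `x_0..x_(h-1)` of degree `≤ n/2` (rows) and the monomials
`q` in `x_h..x_(2h-1)` of degree `≤ n/2` (columns), `SmallCircuits ℂ n 2` hits every polynomial in the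
coefficient variables whose value at every coefficient vector is the determinant of the square
partition coefficient matrix `[coeff_(p + e p') f]_(p, p')` — witness `Σ_(d ≤ n/2) (Σ_(i<h) x_i x_(h+i))^d`
of `stub_partitionRankMaximal` (p161911): its matrix is a nonzero diagonal times the permutation
`e⁻¹ ∘ shift`. [folklore (Nisan 1991); status: LANDED p166133] -/
theorem stub_partitionDeterminantHit :
    ∀ n h : ℕ, 2 ≤ n → 2 * h ≤ n →
      ∀ [Fintype {p : Fin n →₀ ℕ // (∀ i ∈ p.support, (i : ℕ) < h) ∧ 2 * p.degree ≤ n}]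
        (e : {p : Fin n →₀ ℕ // (∀ i ∈ p.support, (i : ℕ) < h) ∧ 2 * p.degree ≤ n} ≃
          {q : Fin n →₀ ℕ // (∀ i ∈ q.support, h ≤ (i : ℕ) ∧ (i : ℕ) < 2 * h) ∧ 2 * q.degree ≤ n}),
      IsSuccinctHittingSet (degLEMonomials n) (SmallCircuits ℂ n 2)
        {D | ∀ f : MvPolynomial (Fin n) ℂ, MvPolynomial.eval (coeffVector (degLEMonomials n) f) D =
          (Matrix.of fun p p' : {p : Fin n →₀ ℕ // (∀ i ∈ p.support, (i : ℕ) < h) ∧ 2 * p.degree ≤ n} =>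
            MvPolynomial.coeff (p.1 + (e p').1) f).det} :=
  -- LANDED: Theorems/BarrierLeverSuccinctHittingSetsForVPStubPartitionDeterminantHit.lean (p166133)
  Summit.ValiantsHypothesis.ValiantsHypothesis.Theorems.BarrierLever.SuccinctHittingSetsForVP.stub_partitionDeterminantHit

/-- STUB NISAN-LEVEL (Nisan's partition determinants are level-8 distinguishers): for `n ≥ 10`,
`2h ≤ n` and `e` as above, some `D ∈ Distinguishers ℂ n 8` computes that determinant on every coefficient
vector — the generic determinant `detPoly` renamed into the coefficient variables `c_(p + e p')`
(`|p + e p'| ≤ n`), of size `≤ 8 (r+1)^7`, `r = #rows ≤ #{m : |m| ≤ n} … ≤ N`, by Berkowitz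
(`complexity_detPoly_le`, `RazDeterminant.rename_detPoly_equiv`, `complexity_rename_le_holds'`) —
mirror of `RazDeterminant.razDet_mem_distinguishers` (p162627). [Berkowitz 1984; status: LANDED p166330] -/
theorem stub_partitionDeterminantLevel :
    ∀ n h : ℕ, 10 ≤ n → 2 * h ≤ n →
      ∀ [Fintype {p : Fin n →₀ ℕ // (∀ i ∈ p.support, (i : ℕ) < h) ∧ 2 * p.degree ≤ n}]
        (e : {p : Fin n →₀ ℕ // (∀ i ∈ p.support, (i : ℕ) < h) ∧ 2 * p.degree ≤ n} ≃
          {q : Fin n →₀ ℕ // (∀ i ∈ q.support, h ≤ (i : ℕ) ∧ (i : ℕ) < 2 * h) ∧ 2 * q.degree ≤ n}),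
      ∃ D ∈ Distinguishers ℂ n 8,
        ∀ f : MvPolynomial (Fin n) ℂ, MvPolynomial.eval (coeffVector (degLEMonomials n) f) D =
          (Matrix.of fun p p' : {p : Fin n →₀ ℕ // (∀ i ∈ p.support, (i : ℕ) < h) ∧ 2 * p.degree ≤ n} =>
            MvPolynomial.coeff (p.1 + (e p').1) f).det :=
  -- LANDED: Theorems/BarrierLeverSuccinctHittingSetsForVPStubPartitionDeterminantLevel.lean (p166330)
  Summit.ValiantsHypothesis.ValiantsHypothesis.Theorems.BarrierLever.SuccinctHittingSetsForVP.stub_partitionDeterminantLevel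

/-! ## Wave 9 (lead c4) — `ΣΠΣ(k)` distinguishers (top fan-in `k ≤ n`) are hit, CONDITIONALLY on
Saxena–Seshadhri's variable reduction (FSV18 §4.1 / Cor. 22 in regime `d = n`) -/

/-- STUB SPSK (lead; CONDITIONAL carve-out): IF Saxena–Seshadhri's Lemma 11 holds (variable reduction
for `ΣΠΣ(k,d,n)` circuits over any field: for `C = Σ_{i<k} ∏_{j<d_i} ℓ_ij ≠ 0` with linear polynomials
`ℓ_ij`, some Vandermonde homomorphism `Ψ_β : x_i ↦ Σ_{j≤k} β^{ij} y_j`, `β` in any set of `d n k² + 1`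
scalars, has `Ψ_β(C) ≠ 0` — [SaxenaSeshadhri2012, Lemma 11 / Thm. 2], stated verbatim as the
hypothesis and vendored as the named fact `SaxenaSeshadhri2012_lemma11`), THEN for `n ≥ 8`, `k ≤ n`,
`SmallCircuits ℂ n 10` hits every nonzero `ΣΠΣ(k)` polynomial in the coefficient variables (affine
forms, any degree): Kronecker renaming + the `k`-seed separable generator (the pulled-back Vandermonde
point is geometric). The case `k = 2` is unconditional (STUB SPS2). Lands as
Theorems/BarrierLeverSuccinctHittingSetsForVPSpsk.lean. [ForbesShpilkaVolk2018 §4.1, Cor. 22;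
SaxenaSeshadhri2012 Lemma 11; status: LANDED p168057 (conditional-result; named fact p168056)] -/
theorem stub_spskHit :
    (∀ (F : Type) [Field F] (k d n : ℕ) (dd : Fin k → ℕ), (∀ i, dd i ≤ d) →
      ∀ (ℓ : (i : Fin k) → Fin (dd i) → MvPolynomial (Fin n) F),
        (∀ i j, (ℓ i j).totalDegree ≤ 1) →
        (∑ i, ∏ j, ℓ i j) ≠ 0 →
        ∀ U : Finset F, d * n * k ^ 2 + 1 ≤ U.card →
          ∃ β ∈ U, MvPolynomial.aeval
            (fun i : Fin n => ∑ j : Fin k,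
              MvPolynomial.C (β ^ ((i.1 + 1) * (j.1 + 1))) * (MvPolynomial.X j : MvPolynomial (Fin k) F))
            (∑ i, ∏ j, ℓ i j) ≠ 0) →
    ∀ n k : ℕ, 8 ≤ n → k ≤ n →
      IsSuccinctHittingSet (degLEMonomials n) (SmallCircuits ℂ n 10)
        {D | ∃ (dd : Fin k → ℕ) (ℓ : (i : Fin k) → Fin (dd i) → MvPolynomial (degLEMonomials n) ℂ),
          (∀ i j, (ℓ i j).totalDegree ≤ 1) ∧ D = ∑ i, ∏ j, ℓ i j} :=
  -- LANDED: Theorems/BarrierLeverSuccinctHittingSetsForVPSpsk.lean (p168057)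
  Summit.ValiantsHypothesis.ValiantsHypothesis.Theorems.BarrierLever.SuccinctHittingSetsForVP.stub_spskHit

/-! ## Wave 10 (lead c5) — GRAM-TYPE RANK METHODS AT EVERY THRESHOLD AND SELECTION; THE LINE'S
GENERATOR TOOLKIT IS PROVABLY INSUFFICIENT; READ-ONCE DISTINGUISHERS (registered after the definition
`Literature.Computability.AlgebraicComplexity.IsPROP`, p172784, lands) -/

/-- STUB PMINORS (every PRINCIPAL catalecticant minor, of any — exponential — size and any selection of
rows, is nonsingular on ONE small circuit): for `n ≥ 8` some `f ∈ SmallCircuits ℂ n 8` — the factorial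
polynomial `f = Σ_{|m| ≤ n} (∏_i m_i!) x^m` of `CatalecticantMaximal.exists_factorial_mem_smallCircuits`
(p161094) — has `det [coeff_(u_i + u_j) f]_(i,j) ≠ 0` for EVERY finite injective family `u : ι ↪ ℕ^n`
with `2|u_i| ≤ n`. Mechanism (generalises STUB CATDET p163487 from the square block `|u| = |w| = k` to
arbitrary row selections of mixed degrees): `R[u, v] = ∏_i (u_i + v_i)! = (G Gᵀ)[u, v]` with
`G[u, t] = ∏_i u_i! C(u_i, t_i)` (`CatalecticantDeterminant.sum_prod_factorial_mul_choose`), and the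
rows of `G` indexed by DISTINCT exponents are linearly independent — the column `t = u₀` of `G` is
supported on `{u ≥ u₀}` (coordinatewise), so a kernel vector `v` of `Gᵀ` restricted to the rows `U`
vanishes at any `u₀ ∈ supp v` of maximal degree (`u ≥ u₀ ∧ |u| ≤ |u₀| ⇒ u = u₀`); hence `R[U, U]`
is positive definite over `ℚ` (Gram matrix of independent vectors) and its determinant is nonzero.
Meaning: no SYMMETRIC moment-matrix rank method — any threshold `r`, any selection `U` of `r` rows of
the catalecticant `[c_(u+v)]`, the minor `det [c_(u_i+u_j)]` being a `poly(r)`-size distinguisher of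
degree `r ≤ 2^(O(n))` — is an algebraically natural proof against `VP` in regime `d = n`.
[folklore (Sylvester; Stieltjes moment matrices / Gram); ForbesShpilkaVolk2018 §1.2; status: OPEN — worker] -/
theorem stub_principalMinors :
    ∀ n : ℕ, 8 ≤ n → ∃ f ∈ SmallCircuits ℂ n 8,
      ∀ (ι : Type) [Fintype ι] [DecidableEq ι] (u : ι → (Fin n →₀ ℕ)), Function.Injective u →
        (∀ i, 2 * (u i).degree ≤ n) →
        (Matrix.of fun i j : ι => MvPolynomial.coeff (u i + u j) f).det ≠ 0 := by
  sorry

/-- STUB PMINORS-HIT (hitting-set form of STUB PMINORS): for `n ≥ 8`, `SmallCircuits ℂ n 8` hits every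
polynomial in the coefficient variables whose value at every coefficient vector is a principal
catalecticant minor `det [coeff_(u_i + u_j) f]` (`u` injective, `2|u_i| ≤ n`) — immediate from
STUB PMINORS (one witness for all of them). [folklore; status: OPEN — worker (with STUB PMINORS)] -/
theorem stub_principalMinorsHit :
    ∀ n : ℕ, 8 ≤ n →
      IsSuccinctHittingSet (degLEMonomials n) (SmallCircuits ℂ n 8)
        {D | ∃ (ι : Type) (_ : Fintype ι) (_ : DecidableEq ι) (u : ι → (Fin n →₀ ℕ)),
          Function.Injective u ∧ (∀ i, 2 * (u i).degree ≤ n) ∧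
          ∀ f : MvPolynomial (Fin n) ℂ, MvPolynomial.eval (coeffVector (degLEMonomials n) f) D =
            (Matrix.of fun i j : ι => MvPolynomial.coeff (u i + u j) f).det} := by
  sorry

/-- STUB LOWRANK (no-go for LOW-PARTITION-RANK generators — the `(t+1)`-minors of a variable-partition
flattening are nonzero level-8 distinguishers annihilating every coefficient vector of flattening rank
`≤ t`): for `n ≥ 10`, `2h ≤ n`, any `t < |κ| ≤ N` and any injective families of row monomials `p_k` (in
`x_0..x_(h-1)`, `2|p_k| ≤ n`) and column monomials `q_k` (in `x_h..x_(n-1)`, `2|q_k| ≤ n`), `k ∈ κ`, the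
minor `D = det [c_(p_k + q_l)]_(k,l)` is a NONZERO member of `Distinguishers ℂ n 8` (generic determinant
renamed injectively into the coefficient variables; Berkowitz size `8(|κ|+1)^7 ≤ N^8`, mirror of
`PartitionDeterminantLevel.partDet_mem_distinguishers` p166330) that computes `det [coeff_(p_k+q_l) f]`
and VANISHES at every `f` whose `κ × κ` block factors through `Fin t` (rank `≤ t < |κ|`:
a kernel vector of the left factor kills the determinant, `Matrix.exists_vecMul_eq_zero_iff`).
[folklore (Nisan 1991 partition rank; flattenings); status: OPEN — worker] -/
theorem stub_lowRankAnnihilated :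
    ∀ n h : ℕ, 10 ≤ n → 2 * h ≤ n →
      ∀ (κ : Type) [Fintype κ] [DecidableEq κ] (t : ℕ), t < Fintype.card κ →
        Fintype.card κ ≤ Nat.choose (2 * n) n →
        ∀ (p q : κ → (Fin n →₀ ℕ)), Function.Injective p → Function.Injective q →
          (∀ k, (∀ i ∈ (p k).support, (i : ℕ) < h) ∧ 2 * (p k).degree ≤ n) →
          (∀ k, (∀ i ∈ (q k).support, h ≤ (i : ℕ)) ∧ 2 * (q k).degree ≤ n) →
          ∃ D ∈ Distinguishers ℂ n 8, D ≠ 0 ∧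
            (∀ f : MvPolynomial (Fin n) ℂ, MvPolynomial.eval (coeffVector (degLEMonomials n) f) D =
              (Matrix.of fun k l : κ => MvPolynomial.coeff (p k + q l) f).det) ∧
            ∀ f : MvPolynomial (Fin n) ℂ,
              (∃ (P : κ → Fin t → ℂ) (Q : Fin t → κ → ℂ),
                  ∀ k l, MvPolynomial.coeff (p k + q l) f = ∑ s, P k s * Q s l) →
                MvPolynomial.eval (coeffVector (degLEMonomials n) f) D = 0 := by
  sorry

/-- STUB SEPSUMS (THE LINE'S GENERATOR TOOLKIT IS ANNIHILATED AT EVERY POLYNOMIAL — INDEED EVERY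
SUBEXPONENTIAL — SEED COUNT): for `n ≥ 10` and every `t < 2^(n/2)` there is ONE nonzero
`D ∈ Distinguishers ℂ n 8` vanishing at every `f` whose degree-`≤ n` coefficients are a sum of `t`
SEPARABLE (rank-one) tensors `Σ_(j<t) ∏_i c_(j,i)(m_i)` — i.e. on the entire image of the `t`-seed
generator of FSV Construction 25 as realised by `stub_separableCoeff` (p153631) sums (`stub_generatorGlue`
p153704 uses `t = 2an` seeds). From STUB LOWRANK with `h = n/2`, rows/columns the `2^h` multilinear
monomials `x_S` (`S ⊆ {0..h-1}`) / `x_(S+h)`: a sum of `t` separable tensors has flattening rank `≤ t`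
(`∏_i c_(j,i)((x_S x_(T+h))_i) = ∏_(i<h) c_(j,i)(𝟙_S i) · ∏_(i≥h) c_(j,i)(𝟙_(T+h) i)`). Consequence for
the line: the crux cannot be settled by adding seeds to the separable/Shpilka–Volkovich generator —
a crux-settling generator must have exponential partition rank across balanced partitions (Raz-type
full rank, cf. STUB RAZ p161281), which small circuits do achieve (STUB PRM p161911).
[folklore; ForbesShpilkaVolk2018 Constr. 25; status: OPEN — worker (with STUB LOWRANK)] -/
theorem stub_separableSumsAnnihilated :
    ∀ n : ℕ, 10 ≤ n → ∀ t : ℕ, t < 2 ^ (n / 2) →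
      ∃ D ∈ Distinguishers ℂ n 8, D ≠ 0 ∧
        ∀ (c : Fin t → Fin n → ℕ → ℂ) (f : MvPolynomial (Fin n) ℂ),
          (∀ m : Fin n →₀ ℕ, m.degree ≤ n → MvPolynomial.coeff m f = ∑ j, ∏ i, c j i (m i)) →
          MvPolynomial.eval (coeffVector (degLEMonomials n) f) D = 0 := by
  sorry

/-- STUB HEART-R (lead c4 — THE SHARPENED HEART IMPLIES LEVEL ONE): if for some `b`, eventually in
`n`, `SmallCircuits ℂ n b` hits every nonzero distinguisher that is simultaneously of level `4`,
HOMOGENEOUS and SUPER-DENSE (`> 2^(n^(b-3))` monomials), then level one holds — the homogeneous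
reduction (`stub_homogeneousReduction`, p164794) composed with the sparse master theorem (Cor. 34 in
regime `d = n`, p152812): a level-one equation for `SmallCircuits ℂ n (b+1)` yields a homogeneous
component that is a homogeneous level-4 EQUATION for `SmallCircuits ℂ n b`, hence super-dense.
With the level collapse: crux ⟺ sharpened heart (`succinctHittingSetsForVP_iff_heart`). Lands as
Theorems/BarrierLeverSuccinctHittingSetsForVPHeart.lean.
[ForbesShpilkaVolk2018 Question 6 / Cor. 34; status: LANDED p165233] -/
theorem stub_heartReduction :
    (∃ b n₀ : ℕ, ∀ n : ℕ, n₀ ≤ n →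
      IsSuccinctHittingSet (degLEMonomials n) (SmallCircuits ℂ n b)
        (Distinguishers ℂ n 4 ∩ {D | D.IsHomogeneous D.totalDegree} ∩
          {D | 2 ^ (n ^ (b - 3)) < D.support.card})) →
    ∃ b n₀ : ℕ, ∀ n : ℕ, n₀ ≤ n →
      IsSuccinctHittingSet (degLEMonomials n) (SmallCircuits ℂ n b) (Distinguishers ℂ n 1) :=
  -- LANDED: Theorems/BarrierLeverSuccinctHittingSetsForVPHeart.lean (p165233)
  Summit.ValiantsHypothesis.ValiantsHypothesis.Theorems.BarrierLever.SuccinctHittingSetsForVP.stub_heartReduction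

/-- STUB HEART (THE OPEN HEART, SHARPEST FORM — FSV Question 6 for BIHOMOGENEOUS, SUPER-DENSE,
LEVEL-16 distinguishers). For some size exponent `b`, eventually in `n`, the coefficient vectors of
`SmallCircuits ℂ n b` hit every nonzero distinguisher `D` in the `N = C(2n,n)` coefficient variables
with `L(D) ≤ N¹⁶`, `deg D ≤ N¹⁶`, `D` HOMOGENEOUS, `D` ISOBARIC for the weight `c_μ ↦ |μ|`, and with MORE
than `2^(n^(b-3))` monomials. EQUIVALENT TO THE CRUX (`succinctHittingSetsForVP_iff_isobaric`, p167193;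
the chain `stub_isobaricReduction` (p167193) → `stub_homogeneousReduction` (p164794) →
`stub_levelCollapse` (p144631) is the registered composition below): a counterexample to FSV
Question 6 over `ℂ` may be assumed bihomogeneous and exponentially dense. Everything the line knows
how to hit has been carved away beside it (low degree, low support, sparse, products of sparse, low
partial dimension / `ΣΛΣ`, few essential variables, `ΣΠΣ(2)`, the catalogue's rank-method minors —
partial derivatives, catalecticants (rows and determinant), partition matrices (rows and Nisan's
determinants), Raz's full-rank determinants); no technique in print touches the residue
(FSV18 Thm. 9–10 stop at roABP-type distinguishers; CKRST20's equations need bounded coefficients).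
[ForbesShpilkaVolk2018, Question 6; status: OPEN PROBLEM — lead] -/
theorem stub_heart :
    ∃ b n₀ : ℕ, ∀ n : ℕ, n₀ ≤ n →
      IsSuccinctHittingSet (degLEMonomials n) (SmallCircuits ℂ n b)
        (Distinguishers ℂ n 16 ∩ {D | D.IsHomogeneous D.totalDegree} ∩
          {D | ∃ k : ℕ, D.IsWeightedHomogeneous (fun μ : degLEMonomials n => (μ : Fin n →₀ ℕ).degree) k} ∩
          {D | 2 ^ (n ^ (b - 3)) < D.support.card}) := by
  sorry

/-- LEVEL ONE FROM THE HEART (the lead's reduction chain, all LANDED): isobaric reduction p167193,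
homogeneous reduction p164794. [ForbesShpilkaVolk2018, Question 6; status: derived from STUB HEART] -/
theorem levelOne_of_stub_heart :
    ∃ b n₀ : ℕ, ∀ n : ℕ, n₀ ≤ n →
      IsSuccinctHittingSet (degLEMonomials n) (SmallCircuits ℂ n b) (Distinguishers ℂ n 1) :=
  stub_homogeneousReduction (stub_isobaricReduction stub_heart)

/-- The v16 heart (homogeneous ∧ super-dense ∧ level 4; equivalent to the crux by
`succinctHittingSetsForVP_iff_heart`, p165233), now DERIVED from STUB HEART through the crux.
[ForbesShpilkaVolk2018, Question 6; status: derived] -/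
theorem stub_heart_v16 :
    ∃ b n₀ : ℕ, ∀ n : ℕ, n₀ ≤ n →
      IsSuccinctHittingSet (degLEMonomials n) (SmallCircuits ℂ n b)
        (Distinguishers ℂ n 4 ∩ {D | D.IsHomogeneous D.totalDegree} ∩
          {D | 2 ^ (n ^ (b - 3)) < D.support.card}) :=
  Summit.ValiantsHypothesis.ValiantsHypothesis.Theorems.BarrierLever.SuccinctHittingSetsForVP.succinctHittingSetsForVP_iff_heart.mp
    (Summit.ValiantsHypothesis.ValiantsHypothesis.Theorems.BarrierLever.SuccinctHittingSetsForVP.succinctHittingSetsForVP_of_levelOne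
      levelOne_of_stub_heart)

/-- FORMER HEART `stub_superDense` (c3; level one for super-dense distinguishers — equivalent to the
crux, `succinctHittingSetsForVP_iff_superDense` p154735), now DERIVED from the sharpened heart:
`superDense_of_levelOne (stub_heartReduction stub_heart)`. [ForbesShpilkaVolk2018, Question 6;
status: derived from STUB HEART] -/
theorem stub_superDense :
    ∃ b n₀ : ℕ, ∀ n : ℕ, n₀ ≤ n →
      IsSuccinctHittingSet (degLEMonomials n) (SmallCircuits ℂ n b)
        (Distinguishers ℂ n 1 ∩ {D | 2 ^ (n ^ (b - 3)) < D.support.card}) :=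
  Summit.ValiantsHypothesis.ValiantsHypothesis.Theorems.BarrierLever.SuccinctHittingSetsForVP.superDense_of_levelOne
    levelOne_of_stub_heart

/-- LANDED (c1 wave 1, p144631): level one implies the Literature constant (every level).
[ForbesShpilkaVolk2018, Cor. 5 / Question 6; status: LANDED] -/
theorem stub_levelCollapse :
    (∃ b n₀ : ℕ, ∀ n : ℕ, n₀ ≤ n →
      IsSuccinctHittingSet (degLEMonomials n) (SmallCircuits ℂ n b) (Distinguishers ℂ n 1)) →
    Literature.Barriers.ValiantsHypothesis.SuccinctHittingSetsForVP ℂ :=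
  Summit.ValiantsHypothesis.ValiantsHypothesis.Theorems.BarrierLever.SuccinctHittingSetsForVP.stub_levelCollapse

/-! ## Glue proved here -/

/-- PRODUCTS OF SPARSE POLYNOMIALS ARE HIT (from the generator): `D = ∏_j E_j` with every `E_j`
`N^a`-sparse and `D ≠ 0`; then `D ∘ Γ = ∏_j (E_j ∘ Γ) ≠ 0` (integral domain), so `D ∘ Γ` has a
non-root `p`, and `Γ(p) = coeff f` for a small circuit `f`. -/
theorem sparseProducts_of_generator
    (hgen : ∀ a : ℕ, ∃ n₀ : ℕ, ∀ n : ℕ, n₀ ≤ n →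
      ∃ (t : ℕ) (Γ : degLEMonomials n → MvPolynomial (Fin t ⊕ (Fin t × Fin n)) ℂ),
        (∀ p : Fin t ⊕ (Fin t × Fin n) → ℂ, ∃ f ∈ SmallCircuits ℂ n 10,
            ∀ μ : degLEMonomials n,
              MvPolynomial.coeff (μ : Fin n →₀ ℕ) f = MvPolynomial.eval p (Γ μ)) ∧
        ∀ D : MvPolynomial (degLEMonomials n) ℂ, D ≠ 0 →
          D.support.card ≤ Nat.choose (2 * n) n ^ a → MvPolynomial.aeval Γ D ≠ 0) :
    ∀ a : ℕ, ∃ n₀ : ℕ, ∀ n : ℕ, n₀ ≤ n →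
      IsSuccinctHittingSet (degLEMonomials n) (SmallCircuits ℂ n 10)
        {D | ∃ (k : ℕ) (E : Fin k → MvPolynomial (degLEMonomials n) ℂ),
          D = ∏ j, E j ∧ ∀ j, (E j).support.card ≤ Nat.choose (2 * n) n ^ a} := by
  intro a
  obtain ⟨n₀, h⟩ := hgen a
  refine ⟨n₀, fun n hn => ?_⟩
  obtain ⟨t, Γ, hreal, hhit⟩ := h n hn
  rintro D ⟨k, E, rfl, hE⟩ hD0
  have hfac : ∀ j ∈ (Finset.univ : Finset (Fin k)), aeval Γ (E j) ≠ 0 := fun j _ =>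
    hhit (E j) (fun h0 => hD0 (Finset.prod_eq_zero (Finset.mem_univ j) h0)) (hE j)
  have hne : aeval Γ (∏ j, E j) ≠ 0 := by
    rw [map_prod]
    exact Finset.prod_ne_zero_iff.mpr hfac
  obtain ⟨p, hp⟩ : ∃ p, eval p (aeval Γ (∏ j, E j)) ≠ 0 := by
    by_contra hcon
    push Not at hcon
    exact hne (MvPolynomial.funext fun v => by simpa using hcon v)
  obtain ⟨f, hf, hcoeff⟩ := hreal p
  refine ⟨f, hf, ?_⟩
  rw [Summit.ValiantsHypothesis.ValiantsHypothesis.Theorems.BarrierLever.SuccinctHittingSetsForVP.LowDegreeEquations.eval_comp_aeval]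
    at hp
  have hv : coeffVector (degLEMonomials n) f = fun μ => eval p (Γ μ) := funext fun μ => hcoeff μ
  rwa [hv]

/-- The sparse half (any single sparse polynomial is a one-factor product). -/
theorem sparse_of_sparseProducts
    (hprod : ∀ a : ℕ, ∃ n₀ : ℕ, ∀ n : ℕ, n₀ ≤ n →
      IsSuccinctHittingSet (degLEMonomials n) (SmallCircuits ℂ n 10)
        {D | ∃ (k : ℕ) (E : Fin k → MvPolynomial (degLEMonomials n) ℂ),
          D = ∏ j, E j ∧ ∀ j, (E j).support.card ≤ Nat.choose (2 * n) n ^ a}) :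
    ∃ n₀ : ℕ, ∀ n : ℕ, n₀ ≤ n →
      IsSuccinctHittingSet (degLEMonomials n) (SmallCircuits ℂ n 10)
        {D : MvPolynomial (degLEMonomials n) ℂ | D.support.card ≤ Nat.choose (2 * n) n} := by
  obtain ⟨n₀, h⟩ := hprod 1
  refine ⟨n₀, fun n hn => (h n hn).mono le_rfl ?_⟩
  intro D hD
  refine ⟨1, fun _ => D, (Fin.prod_univ_one fun _ => D).symm, fun _ => ?_⟩
  have hD' : D.support.card ≤ Nat.choose (2 * n) n := hD
  simpa only [pow_one] using hD'

/-- LEVEL ONE FROM ITS TWO HALVES: a level-one distinguisher has either `≤ N` or `> N` monomials;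
both classes are hit at the size exponent `max 10 b` (monotonicity of `SmallCircuits` in `b`). -/
theorem levelOne_of_sparse_dense
    (hs : ∃ n₀ : ℕ, ∀ n : ℕ, n₀ ≤ n →
      IsSuccinctHittingSet (degLEMonomials n) (SmallCircuits ℂ n 10)
        {D : MvPolynomial (degLEMonomials n) ℂ | D.support.card ≤ Nat.choose (2 * n) n})
    (hd : ∃ b n₀ : ℕ, ∀ n : ℕ, n₀ ≤ n →
      IsSuccinctHittingSet (degLEMonomials n) (SmallCircuits ℂ n b)
        (Distinguishers ℂ n 1 ∩ {D | Nat.choose (2 * n) n < D.support.card})) :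
    ∃ b n₀ : ℕ, ∀ n : ℕ, n₀ ≤ n →
      IsSuccinctHittingSet (degLEMonomials n) (SmallCircuits ℂ n b) (Distinguishers ℂ n 1) := by
  obtain ⟨n₁, hs⟩ := hs
  obtain ⟨b, n₂, hd⟩ := hd
  refine ⟨max 10 b, max (max n₁ n₂) 1, fun n hn => ?_⟩
  have hn₁ : n₁ ≤ n := le_trans (le_max_left _ _) (le_trans (le_max_left _ _) hn)
  have hn₂ : n₂ ≤ n := le_trans (le_max_right _ _) (le_trans (le_max_left _ _) hn)
  have hn1 : 1 ≤ n := le_trans (le_max_right _ _) hn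
  intro D hD hD0
  by_cases hcard : D.support.card ≤ Nat.choose (2 * n) n
  · obtain ⟨f, hf, hne⟩ := hs n hn₁ D hcard hD0
    exact ⟨f, smallCircuits_mono ℂ (le_max_left 10 b) hn1 hf, hne⟩
  · obtain ⟨f, hf, hne⟩ := hd n hn₂ D ⟨hD, not_le.mp hcard⟩ hD0
    exact ⟨f, smallCircuits_mono ℂ (le_max_right 10 b) hn1 hf, hne⟩

/-! ## The composition -/

/-- COMPOSITION registered with the gate (`ledger skeleton check`): the route's crux
`BarrierLever.SuccinctHittingSetsForVP` BY NAME from the declared stubs; the route decl unfolds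
(by `rfl`) to the Literature constant that `stub_levelCollapse` concludes. -/
theorem SuccinctHittingSetsForVP_of :
    Summit.ValiantsHypothesis.ValiantsHypothesis.Theses.BarrierLever.SuccinctHittingSetsForVP :=
  stub_levelCollapse (stub_homogeneousReduction (stub_isobaricReduction stub_heart))

/-- The c3 composition through the former heart, kept for the record (same proof term up to the
derivation of `stub_superDense`). -/
theorem SuccinctHittingSetsForVP_of_superDense :
    Summit.ValiantsHypothesis.ValiantsHypothesis.Theses.BarrierLever.SuccinctHittingSetsForVP :=
  stub_levelCollapse (stub_levelOneOfSuperDense stub_superDense)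

/-- The wave-1/2 route to level one, kept for the record: sparse products (landed) + the dense case at
threshold `N` would also give level one; the dense case at threshold `N` follows from STUB D⁺ via
STUB R (level one implies every restricted case). -/
theorem levelOne_of_superDense_via_products
    (hR : (∃ b n₀ : ℕ, ∀ n : ℕ, n₀ ≤ n →
      IsSuccinctHittingSet (degLEMonomials n) (SmallCircuits ℂ n b)
        (Distinguishers ℂ n 1 ∩ {D | 2 ^ (n ^ (b - 3)) < D.support.card})) →
      ∃ b n₀ : ℕ, ∀ n : ℕ, n₀ ≤ n →
        IsSuccinctHittingSet (degLEMonomials n) (SmallCircuits ℂ n b) (Distinguishers ℂ n 1))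
    (hD : ∃ b n₀ : ℕ, ∀ n : ℕ, n₀ ≤ n →
      IsSuccinctHittingSet (degLEMonomials n) (SmallCircuits ℂ n b)
        (Distinguishers ℂ n 1 ∩ {D | 2 ^ (n ^ (b - 3)) < D.support.card})) :
    ∃ b n₀ : ℕ, ∀ n : ℕ, n₀ ≤ n →
      IsSuccinctHittingSet (degLEMonomials n) (SmallCircuits ℂ n b) (Distinguishers ℂ n 1) := by
  obtain ⟨b, n₀, h⟩ := hR hD
  exact levelOne_of_sparse_dense (sparse_of_sparseProducts stub_sparseProducts)
    ⟨b, n₀, fun n hn => (h n hn).mono le_rfl Set.inter_subset_left⟩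

end Summit.ValiantsHypothesis.ValiantsHypothesis.Cruxes.SuccinctHittingSetsForVP.Birth
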